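import Summits.Ventures.PercRepro.ProfilePointedCircuitClassesInOutFreeII

/-!
# PercRepro — THE PARALLEL-PAIRS BOUND (p5, gen 38; `proofs/P5-GM1.md` §54 ADDENDUM 3 (1))

For `T ⊆ E` and a set `Z ⊆ E` avoiding `cl(T)` with `ρ(T ∪ Z) + δ = ρ(T) + #Z` («`Z` has nullity `δ` modulo `T`»),
at most `C(δ + 1, 2)` pairs `{c, d} ⊆ Z` satisfy `ρ(T ∪ {c, d}) = ρ(T) + 1` («parallel modulo `T`»).  Induction on
`δ`: a bad pair `{c, d}` lets `d` go (`d ∈ cl(T + c)`, so `ρ(T ∪ (Z − d)) = ρ(T ∪ Z)`), and the bad pairs through `d`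
are the points of `Z − d` in `cl(T + d)`, at most `δ + 1` of them.  Used for the mixed family `(f, g)` of a nullity-3
matroid (ProfilePointedCircuitClassesInOutTriangle).

* **`card_filter_bad_pairs_le`**.
-/

open scoped Matroid

namespace PercRepro.Cogirth

open Finset ThmH Skew Shadow Profile

variable {α : Type} [DecidableEq α] {M : Matroid α} [M.Finite]

section BadPairs

/-- **THE PARALLEL-PAIRS BOUND**: for `T ⊆ E` and `Z ⊆ E` avoiding `cl(T)` with `ρ(T ∪ Z) + δ = ρ(T) + #Z` («`Z` has
nullity `δ` modulo `T`»), at most `C(δ + 1, 2)` pairs `{c, d} ⊆ Z` satisfy `ρ(T ∪ {c, d}) = ρ(T) + 1`.  Induction on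
`δ`: a bad pair `{c, d}` lets `d` go (`d ∈ cl(T + c)`), the pairs through `d` are the points of `Z − d` in
`cl(T + d)`, at most `δ + 1` of them. -/
theorem card_filter_bad_pairs_le (T : Finset α) (hT : T ⊆ gr M) :
    ∀ (δ : ℕ) (Z : Finset α), Z ⊆ gr M → (∀ z ∈ Z, z ∉ clF M T) → rk M (T ∪ Z) + δ = rk M T + Z.card →
      ((Z.powersetCard 2).filter (fun p => rk M (T ∪ p) = rk M T + 1)).card ≤ (δ + 1).choose 2 := by
  intro δ
  induction δ with
  | zero =>
    intro Z hZg hZcl hrk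
    have h0 : (0 + 1).choose 2 = 0 := by norm_num
    -- no bad pair: a bad pair `{c, d}` would give `ρ(T ∪ Z) ≤ ρ(T) + #Z − 1`
    rw [h0, Nat.le_zero, card_eq_zero, filter_eq_empty_iff]
    intro p hp hbad
    rw [mem_powersetCard] at hp
    obtain ⟨hpZ, hp2⟩ := hp
    obtain ⟨c, d, hcd, rfl⟩ := card_eq_two.1 hp2
    have hcZ : c ∈ Z := hpZ (mem_insert_self _ _)
    have hdZ : d ∈ Z := hpZ (mem_insert_of_mem (mem_singleton_self _))
    have hcg : c ∈ gr M := hZg hcZ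
    have hdg : d ∈ gr M := hZg hdZ
    -- `d ∈ cl(T + c)`
    have hrkTc : rk M (insert c T) = rk M T + 1 := by
      rw [rk_insert_eq hcg hT, if_neg (hZcl c hcZ)]
    have hdcl : d ∈ clF M (insert c T) := by
      rw [mem_clF_iff_rk_insert_eq hdg (insert_subset hcg hT)]
      have e1 : insert d (insert c T) = T ∪ {c, d} := by
        ext a; simp only [mem_insert, mem_union, mem_singleton]; tauto
      rw [e1, hbad, hrkTc]
    -- hence `T ∪ Z ⊆ cl(T ∪ (Z − d))`
    have hsub : T ∪ Z ⊆ clF M (T ∪ Z.erase d) := by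
      intro a ha
      by_cases had : a = d
      · subst had
        exact mem_clF_of_subset (insert_subset (mem_union_right _ (mem_erase.2 ⟨hcd, hcZ⟩)) subset_union_left) hdcl
      · rw [mem_union] at ha
        apply mem_clF_of_mem_of_subset_gr (union_subset hT ((erase_subset _ _).trans hZg))
        rw [mem_union]
        rcases ha with h | h
        · exact Or.inl h
        · exact Or.inr (mem_erase.2 ⟨had, h⟩)
    have h1 := rk_le_rk_of_subset_finset (M := M) hsub
    rw [rk_clF_eq_rk] at h1
    have h2 := rk_le_card (M := M) (Z.erase d)
    have h3 := rk_union_le (M := M) T (Z.erase d)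
    rw [card_erase_of_mem hdZ] at h2
    have h4 : 1 ≤ Z.card := card_pos.2 ⟨d, hdZ⟩
    omega
  | succ δ ih =>
    intro Z hZg hZcl hrk
    rcases ((Z.powersetCard 2).filter (fun p => rk M (T ∪ p) = rk M T + 1)).eq_empty_or_nonempty with hemp | ⟨p₀, hp₀⟩
    · rw [hemp, card_empty]
      exact Nat.zero_le _
    rw [mem_filter, mem_powersetCard] at hp₀
    obtain ⟨⟨hp₀Z, hp₀2⟩, hbad₀⟩ := hp₀
    obtain ⟨c, d, hcd, rfl⟩ := card_eq_two.1 hp₀2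
    have hcZ : c ∈ Z := hp₀Z (mem_insert_self _ _)
    have hdZ : d ∈ Z := hp₀Z (mem_insert_of_mem (mem_singleton_self _))
    have hcg : c ∈ gr M := hZg hcZ
    have hdg : d ∈ gr M := hZg hdZ
    have hrkTc : rk M (insert c T) = rk M T + 1 := by
      rw [rk_insert_eq hcg hT, if_neg (hZcl c hcZ)]
    have hrkTd : rk M (insert d T) = rk M T + 1 := by
      rw [rk_insert_eq hdg hT, if_neg (hZcl d hdZ)]
    have hdcl : d ∈ clF M (insert c T) := by
      rw [mem_clF_iff_rk_insert_eq hdg (insert_subset hcg hT)]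
      have e1 : insert d (insert c T) = T ∪ {c, d} := by
        ext a; simp only [mem_insert, mem_union, mem_singleton]; tauto
      rw [e1, hbad₀, hrkTc]
    set Z' := Z.erase d with hZ'
    have hZ'g : Z' ⊆ gr M := (erase_subset _ _).trans hZg
    have hcZ' : c ∈ Z' := mem_erase.2 ⟨hcd, hcZ⟩
    have hZ'card : Z'.card + 1 = Z.card := by rw [hZ', card_erase_of_mem hdZ]; have := card_pos.2 ⟨d, hdZ⟩; omega
    -- `ρ(T ∪ Z') = ρ(T ∪ Z)`
    have hrkZ' : rk M (T ∪ Z') = rk M (T ∪ Z) := by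
      apply le_antisymm (rk_le_rk_of_subset_finset (union_subset_union (Subset.refl _) (erase_subset _ _)))
      have hsub : T ∪ Z ⊆ clF M (T ∪ Z') := by
        intro a ha
        by_cases had : a = d
        · subst had
          exact mem_clF_of_subset (insert_subset (mem_union_right _ hcZ') subset_union_left) hdcl
        · rw [mem_union] at ha
          apply mem_clF_of_mem_of_subset_gr (union_subset hT hZ'g)
          rw [mem_union]
          rcases ha with h | h
          · exact Or.inl h
          · exact Or.inr (mem_erase.2 ⟨had, h⟩)
      have := rk_le_rk_of_subset_finset (M := M) hsub
      rwa [rk_clF_eq_rk] at this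
    have hZ'cl : ∀ z ∈ Z', z ∉ clF M T := fun z hz => hZcl z (erase_subset _ _ hz)
    have hrkZ'' : rk M (T ∪ Z') + δ = rk M T + Z'.card := by omega
    have hih := ih Z' hZ'g hZ'cl hrkZ''
    -- the bad pairs through `d` are the points of `Z'` in `cl(T + d)`: at most `δ + 1`
    obtain ⟨A, hA⟩ : ∃ A : Finset α, A = Z'.filter (fun x => x ∈ clF M (insert d T)) := ⟨_, rfl⟩
    have hAZ' : A ⊆ Z' := by rw [hA]; exact filter_subset _ _
    have hAcard : A.card ≤ δ + 1 := by
      have hcA : c ∈ A := by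
        rw [hA, mem_filter]
        refine ⟨hcZ', ?_⟩
        rw [mem_clF_iff_rk_insert_eq hcg (insert_subset hdg hT)]
        have e1 : insert c (insert d T) = T ∪ {c, d} := by
          ext a; simp only [mem_insert, mem_union, mem_singleton]; tauto
        rw [e1, hbad₀, hrkTd]
      -- `ρ(T ∪ A) = ρ(T) + 1` and `T ∪ Z' ⊆ (T ∪ A) ∪ (Z' \ A)`
      have hAg : A ⊆ gr M := hAZ'.trans hZ'g
      have hTA : rk M (T ∪ A) ≤ rk M T + 1 := by
        have hsub : T ∪ A ⊆ clF M (insert d T) := by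
          intro a ha
          rw [mem_union] at ha
          rcases ha with h | h
          · exact mem_clF_of_mem_of_subset_gr (insert_subset hdg hT) (mem_insert_of_mem h)
          · rw [hA, mem_filter] at h
            exact h.2
        have := rk_le_rk_of_subset_finset (M := M) hsub
        rwa [rk_clF_eq_rk, hrkTd] at this
      have hsplit : T ∪ Z' ⊆ (T ∪ A) ∪ (Z' \ A) := by
        intro a ha
        rw [mem_union] at ha ⊢
        rcases ha with h | h
        · exact Or.inl (mem_union_left _ h)
        · by_cases haA : a ∈ A
          · exact Or.inl (mem_union_right _ haA)
          · exact Or.inr (mem_sdiff.2 ⟨h, haA⟩)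
      have h1 := rk_le_rk_of_subset_finset (M := M) hsplit
      have h2 := rk_union_le (M := M) (T ∪ A) (Z' \ A)
      have h3 := rk_le_card (M := M) (Z' \ A)
      rw [card_sdiff_of_subset hAZ'] at h3
      have h4 : A.card ≤ Z'.card := card_le_card hAZ'
      omega
    -- split the bad pairs of `Z = insert d Z'`
    have hZeq : Z = insert d Z' := by rw [hZ', insert_erase hdZ]
    have hdZ' : d ∉ Z' := fun h => (mem_erase.1 h).1 rfl
    have hsplit : (Z.powersetCard 2).filter (fun p => rk M (T ∪ p) = rk M T + 1) ⊆
        (Z'.powersetCard 2).filter (fun p => rk M (T ∪ p) = rk M T + 1) ∪ A.image (fun x => insert d ({x} : Finset α)) := by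
      intro p hp
      rw [mem_filter, mem_powersetCard] at hp
      obtain ⟨⟨hpZ, hp2⟩, hbad⟩ := hp
      rw [mem_union]
      by_cases hdp : d ∈ p
      · right
        obtain ⟨x, hxp, hxd⟩ := exists_mem_notMem_of_card_lt_card (show ({d} : Finset α).card < p.card by rw [card_singleton, hp2]; norm_num)
        rw [mem_singleton] at hxd
        have hpe : p = insert d {x} := by
          apply (eq_of_subset_of_card_le _ _).symm
          · exact insert_subset hdp (singleton_subset_iff.2 hxp)
          · rw [card_insert_of_notMem (fun h => hxd (mem_singleton.1 h).symm), card_singleton, hp2]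
        rw [mem_image]
        refine ⟨x, ?_, hpe.symm⟩
        rw [hA, mem_filter]
        have hxZ' : x ∈ Z' := mem_erase.2 ⟨hxd, hpZ hxp⟩
        refine ⟨hxZ', ?_⟩
        rw [mem_clF_iff_rk_insert_eq (hZ'g hxZ') (insert_subset hdg hT)]
        have e1 : insert x (insert d T) = T ∪ p := by
          rw [hpe]; ext a; simp only [mem_insert, mem_union, mem_singleton]; tauto
        rw [e1, hbad, hrkTd]
      · left
        rw [mem_filter, mem_powersetCard]
        exact ⟨⟨fun a ha => mem_erase.2 ⟨fun h => hdp (h ▸ ha), hpZ ha⟩, hp2⟩, hbad⟩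
    have h5 := card_le_card hsplit
    have h6 := card_union_le ((Z'.powersetCard 2).filter (fun p => rk M (T ∪ p) = rk M T + 1)) (A.image (fun x => insert d ({x} : Finset α)))
    have h7 : (A.image (fun x => insert d ({x} : Finset α))).card ≤ A.card := card_image_le
    have hch : (δ + 1 + 1).choose 2 = (δ + 1).choose 2 + (δ + 1) := by
      rw [Nat.choose_two_right, Nat.choose_two_right, Nat.triangle_succ]
    omega

end BadPairs

end PercRepro.Cogirth
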